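/-
Copyright (c) 2026. Released under Apache 2.0 license as described in the file LICENSE.
Track B ∕ K2-LIT (cell `hodgecm-mathlib`, squad K2, ENGINE E1), crux h413 = `stmt-HodgeConjecture-24833`, route of record `HCCMUnconditional`.
Prover seat `hodgecm-mathlib-K2E3-p12` (g7).  Deal «P8 PROPER» ruling 09:33:29Z (P8-β: the structural discharges of ★ `sphericalEisenstein_meromorphicOn_ball_of_letters` for the closer).
-/
import Summits.HodgeConjecture.HodgeConjecture.Theorems.K2E1BLHeckeOperatorHXU2Op         -- ★ P3-C: `exists_shiftOperatorX_of_isCompact`, `deltaShift_comp_iota`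
import Summits.HodgeConjecture.HodgeConjecture.Theorems.K2E1BLShiftBoundU2                -- ★ P3-B: `shiftBound_of_isCompact`
import Summits.HodgeConjecture.HodgeConjecture.Theorems.K2E1BLIotaClosedEmbeddingU2        -- ★ P2a-ι CM: `isFiniteMeasure_weightedTruncMeasure_cm`
import Summits.HodgeConjecture.HodgeConjecture.Theorems.K2E1BLIotaBoundU2                 -- ★ P2a-ι CM: `exists_pos_forall_mul_lintegral_le_lintegral_comp_pZX_cm`
import HarnessLib

/-!
# K2·E1 — `K2E1SphericalEisensteinMeromorphicSuppliersU2`: STRUCTURAL SUPPLIERS OF THE P8 CLOSER — (§1) the «HECKE PACKAGE» of a compactly supported test function `h`: ONE constant `κ ≥ 1`, the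
# `𝔛`-side operator `T_X` (★ P3-C) and, at all levels `κ·c ≤ c₀`, the letter `ShiftBound` (★ P3-B) together with the intertwining `δ(h) ∘ ι = restr ∘ ι ∘ T_X` (★ P3-C); (§2) finiteness
# `μZ(Z_c) < ∞` and non-vanishing `μZ(Z_c) ≠ 0` of the truncated measures (generic reductions + the CM `N = 2` discharge) [arXiv:1911.02342, §4 Claims 4–5]

Track B ∕ K2-LIT, crux h413 = `stmt-HodgeConjecture-24833`, route of record `HCCMUnconditional`; cell `hodgecm-mathlib`, squad K2, ENGINE E1 (campaign EIS-R7-BL-SPH-2, P8 PROPER, ruling 09:33:29Z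
«P8-β := `hα₁ hα₂ hα₂ne` + the ι-package ∕ `hfin` ∕ `IsFiniteMeasure` CM discharges»).  Prover seat `hodgecm-mathlib-K2E3-p12` (g7).  THEOREMS ONLY (no `def`, no `instance`, no notation, no named-fact
hypothesis, no `sorry`); lane `--supports stmt-HodgeConjecture-24833 --as helper` (count-neutral).  Closes no socket.  §1 and §2a RANK-GENERIC; §2b is the CM `N = 2` discharge.
§1 `borelQuotHeight_le_mul_rightShift_of_forall` (descending a height comparison to `Z`), **`exists_heckePackage`** (`h` continuous of compact support, `hright` ⟹ `∃ κ ≥ 1, ∃ T_X` with the a.e.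
formula of ★ `exists_shiftOperatorX`, and `∀ c₁ ≤ c₀` with `κ c₁ ≤ c₀`: `∃ hs : ShiftBound k c₁ c₀ νG μZ h, ∀ hb, deltaShift hs ∘L iota hb = restrHN ∘L iota hb ∘L T_X` — the letters `hs`, `T`, `hδι` of ★ P8 §2 at once).
§2a `measure_setOf_lt_ne_top_of_isFiniteMeasure` (`wtm 0 c μZ = μZ|_{Z_c}`), `measure_setOf_lt_ne_zero_of_weightedTruncMeasure_ne_zero`.  §2b CM: **`measure_setOf_lt_ne_top_cm`** (★
`isFiniteMeasure_weightedTruncMeasure_cm` at `k = 0`) and **`exists_pos_forall_measure_setOf_lt_ne_zero_cm`** (★ unfolding lower bound at `Φ ≡ 1` + `μ` positive on opens) — the letters `hfin`, `hne`.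
HONEST LABEL: HC_CM is proved only modulo the 7 printed citations (2 remaining named inputs: hLiu418 = `stmt-HodgeConjecture-24832`, h413 = `stmt-HodgeConjecture-24833`) until rung 0
closes; this file asserts no named fact and closes no socket.
References: [BernsteinLapid2019] J. Bernstein, E. Lapid, *On the meromorphic continuation of Eisenstein series*, arXiv:1911.02342 (JAMS 37 (2024), doi:10.1090/jams/1020), §4 Claims 4–5, p. 10 ·
[MoeglinWaldspurger1995] C. Mœglin, J.-L. Waldspurger, *Spectral Decomposition and Eisenstein Series*, I.2.13.
-/

set_option autoImplicit false
-- the mandated namespace repeats the single-problem summit's segment (`HodgeConjecture.HodgeConjecture`)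
set_option linter.dupNamespace false

noncomputable section

open MeasureTheory Filter Topology Set NumberField
open scoped NNReal ENNReal
open Literature.MeasureTheory.Group Literature.NumberTheory.Automorphic Literature.NumberTheory.Automorphic.UnitaryGroup AdelicGroupData
open Summit.HodgeConjecture.HodgeConjecture.Cruxes.H413.K2E1BLBorelSpacesU2Defs
open Summit.HodgeConjecture.HodgeConjecture.Cruxes.H413.K2E1BLBorelOperatorsU2Defs
open Summit.HodgeConjecture.HodgeConjecture.Cruxes.H413.K2E1BLHeckeOperatorWeightedU2 (exists_borelHeight_mul_le_of_isCompact)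
open Summit.HodgeConjecture.HodgeConjecture.Cruxes.H413.K2E1BLShiftBoundU2 (shiftBound_of_isCompact)
open Summit.HodgeConjecture.HodgeConjecture.Cruxes.H413.K2E1BLHeckeOperatorHXU2Op (exists_shiftOperatorX_of_isCompact deltaShift_comp_iota)
open Summit.HodgeConjecture.HodgeConjecture.Cruxes.H413.K2E1BLIotaBoundU2 (exists_pos_forall_mul_lintegral_le_lintegral_comp_pZX_cm measurable_supHeight)
open Summit.HodgeConjecture.HodgeConjecture.Cruxes.H413.K2E1BLIotaClosedEmbeddingU2 (isFiniteMeasure_weightedTruncMeasure_cm)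
open Summit.HodgeConjecture.HodgeConjecture.Cruxes.H413.K2E1BLHeckeOperatorHXU2 (supHeight_pos)

namespace Summit.HodgeConjecture.HodgeConjecture.Cruxes.H413.K2E1SphericalEisensteinMeromorphicSuppliersU2

/-! ## §1 The Hecke package of a compactly supported test function -/

section Hecke

variable {F E : Type} [Field F] [NumberField F] [Field E] [NumberField E] [Algebra F E] {c : E ≃ₐ[F] E} {N : ℕ} [NeZero N]

/-- A height comparison `H(x) ≤ κ·H(x·y)` on `G(𝔸)` descends to `Z`: `HZ z ≤ κ·HZ(z·y)`. [cite: BernsteinLapid2019, §4 p. 10] -/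
theorem borelQuotHeight_le_mul_rightShift_of_forall {Ω : Set (quasiSplit F E c N).Adelic} {κ : ℝ≥0}
    (hκ : ∀ x : (quasiSplit F E c N).Adelic, ∀ y ∈ Ω, borelHeight x ≤ κ * borelHeight (x * y)) (z : borelQuotient F E c N) {y : (quasiSplit F E c N).Adelic} (hy : y ∈ Ω) :
    borelQuotHeight F E c N z ≤ κ * borelQuotHeight F E c N (rightShift F E c N y z) := by
  induction z using Quotient.inductionOn with
  | h g => exact hκ g y hy

variable [MeasurableSpace (quasiSplit F E c N).Adelic] [BorelSpace (quasiSplit F E c N).Adelic]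

/-- **THE HECKE PACKAGE OF `h`** (continuous, compact support): ONE `κ ≥ 1`, the `𝔛`-side operator `T_X` with `T_X u =ᵐ ∫ h(y)·u(y⁻¹•·) dνG` (★ P3-C `exists_shiftOperatorX_of_isCompact`), and for all levels
`c₁ ≤ c₀` with `κ·c₁ ≤ c₀` the letter `ShiftBound k c₁ c₀ νG μZ h` (★ P3-B `shiftBound_of_isCompact`) together with the intertwining `δ(h) ∘ ι_{c₁} = restr ∘ ι_{c₁} ∘ T_X` (★ P3-C
`deltaShift_comp_iota`; comparison ★ P3-A `exists_borelHeight_mul_le_of_isCompact` descended to `Z`) — the letters `hs`, `T`, `hδι` of ★ `sphericalEisenstein_meromorphicOn_ball_of_letters` in one stroke.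
[cite: BernsteinLapid2019, §4 Claim 4 bullet 5 and Claim 5] [cite: MoeglinWaldspurger1995, I.2.13] -/
theorem exists_heckePackage (νG : Measure (quasiSplit F E c N).Adelic) [SFinite νG] (μ : Measure (quasiSplit F E c N).automorphicQuotient) [SFinite μ]
    [SMulInvariantMeasure (quasiSplit F E c N).Adelic (quasiSplit F E c N).automorphicQuotient μ] (μZ : Measure (borelQuotient F E c N)) [SFinite μZ] (hright : ∀ y, MeasurePreserving (rightShift F E c N y) μZ μZ) {h : (quasiSplit F E c N).Adelic → ℂ} (hhc : Continuous h)
    (hhs : HasCompactSupport h) (hhi : Integrable h νG) (k : ℕ) :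
    ∃ κ : ℝ≥0, 1 ≤ κ ∧ ∃ T : HX F E c N k μ →L[ℂ] HX F E c N k μ,
      (∀ u : HX F E c N k μ, (T u : (quasiSplit F E c N).automorphicQuotient → ℂ) =ᵐ[μ.withDensity fun x => (((supHeight F E c N x)⁻¹ ^ (2 * k) : ℝ≥0) : ℝ≥0∞)]
        fun ξ => ∫ y, h y * (u : (quasiSplit F E c N).automorphicQuotient → ℂ) (y⁻¹ • ξ) ∂νG) ∧
      ∀ (c₁ c₀ : ℝ≥0) (h01 : c₁ ≤ c₀), κ * c₁ ≤ c₀ → ∃ hs : ShiftBound F E c N k c₁ c₀ νG μZ h,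
        ∀ hb : IotaBound F E c N k c₁ μ μZ, deltaShift hs ∘L iota hb = restrHN F E c N k h01 μZ ∘L iota hb ∘L T := by
  -- the support and its comparison constants
  have hΩc : IsCompact (tsupport h) := hhs
  have hΩm : MeasurableSet (tsupport h) := (isClosed_tsupport h).measurableSet
  have hsupp : ∀ y, y ∉ tsupport h → h y = 0 := fun y hy => image_eq_zero_of_notMem_tsupport hy
  obtain ⟨κ₁, -, hT⟩ := exists_shiftOperatorX_of_isCompact (k := k) νG μ hΩc
  obtain ⟨T, hTf, -⟩ := hT h hhc.measurable hhi hsupp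
  obtain ⟨κ₂, hκ₂, hsB⟩ := shiftBound_of_isCompact (νG := νG) (μZ := μZ) hright hΩc
  obtain ⟨κ₃, hκ₃, hcmp⟩ := exists_borelHeight_mul_le_of_isCompact (F := F) (E := E) (c := c) (N := N) hΩc
  refine ⟨max κ₂ κ₃, hκ₂.trans (le_max_left _ _), T, hTf, fun c₁ c₀ h01 hc => ?_⟩
  have hs : ShiftBound F E c N k c₁ c₀ νG μZ h := hsB k c₁ c₀ ((mul_le_mul_of_nonneg_right (le_max_left κ₂ κ₃) zero_le).trans hc) h hhc.measurable hhi hsupp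
  refine ⟨hs, fun hb => ?_⟩
  refine deltaShift_comp_iota νG μ μZ hs hb h01 hright hΩm (lt_of_lt_of_le zero_lt_one (hκ₃.trans (le_max_right _ _))) hc (fun z y hy => ?_) hsupp T hTf
  exact (borelQuotHeight_le_mul_rightShift_of_forall (fun x y hy => (hcmp x y hy).2) z hy).trans (mul_le_mul_of_nonneg_right (le_max_right κ₂ κ₃) zero_le)


/-- **THE HECKE PACKAGE, WITH THE HEIGHT COMPARISON EXPORTED** (ED. 2): as `exists_heckePackage`, and in addition the one-sided comparison `HZ z ≤ κ·HZ(z·y)` for `y ∈ tsupport h` with the SAME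
`κ` — the input of ★-to-be P6′ (i) `exists_ae_norm_deltaShift_le_of_ae_eq_cpow` (K2E1-p02), so that the closer can pay `hδα₂` from the package. [cite: BernsteinLapid2019, §4 Claim 4 bullet 5 and Claim 5]
[cite: MoeglinWaldspurger1995, I.2.13] -/
theorem exists_heckePackage' (νG : Measure (quasiSplit F E c N).Adelic) [SFinite νG] (μ : Measure (quasiSplit F E c N).automorphicQuotient) [SFinite μ]
    [SMulInvariantMeasure (quasiSplit F E c N).Adelic (quasiSplit F E c N).automorphicQuotient μ] (μZ : Measure (borelQuotient F E c N)) [SFinite μZ]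
    (hright : ∀ y, MeasurePreserving (rightShift F E c N y) μZ μZ) {h : (quasiSplit F E c N).Adelic → ℂ} (hhc : Continuous h)
    (hhs : HasCompactSupport h) (hhi : Integrable h νG) (k : ℕ) :
    ∃ κ : ℝ≥0, 1 ≤ κ ∧ (∀ z : borelQuotient F E c N, ∀ y ∈ tsupport h, borelQuotHeight F E c N z ≤ κ * borelQuotHeight F E c N (rightShift F E c N y z)) ∧
      ∃ T : HX F E c N k μ →L[ℂ] HX F E c N k μ,
      (∀ u : HX F E c N k μ, (T u : (quasiSplit F E c N).automorphicQuotient → ℂ) =ᵐ[μ.withDensity fun x => (((supHeight F E c N x)⁻¹ ^ (2 * k) : ℝ≥0) : ℝ≥0∞)]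
        fun ξ => ∫ y, h y * (u : (quasiSplit F E c N).automorphicQuotient → ℂ) (y⁻¹ • ξ) ∂νG) ∧
      ∀ (c₁ c₀ : ℝ≥0) (h01 : c₁ ≤ c₀), κ * c₁ ≤ c₀ → ∃ hs : ShiftBound F E c N k c₁ c₀ νG μZ h,
        ∀ hb : IotaBound F E c N k c₁ μ μZ, deltaShift hs ∘L iota hb = restrHN F E c N k h01 μZ ∘L iota hb ∘L T := by
  have hΩc : IsCompact (tsupport h) := hhs
  have hΩm : MeasurableSet (tsupport h) := (isClosed_tsupport h).measurableSet
  have hsupp : ∀ y, y ∉ tsupport h → h y = 0 := fun y hy => image_eq_zero_of_notMem_tsupport hy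
  obtain ⟨κ₁, -, hT⟩ := exists_shiftOperatorX_of_isCompact (k := k) νG μ hΩc
  obtain ⟨T, hTf, -⟩ := hT h hhc.measurable hhi hsupp
  obtain ⟨κ₂, hκ₂, hsB⟩ := shiftBound_of_isCompact (νG := νG) (μZ := μZ) hright hΩc
  obtain ⟨κ₃, hκ₃, hcmp⟩ := exists_borelHeight_mul_le_of_isCompact (F := F) (E := E) (c := c) (N := N) hΩc
  have hcmp' : ∀ z : borelQuotient F E c N, ∀ y ∈ tsupport h, borelQuotHeight F E c N z ≤ max κ₂ κ₃ * borelQuotHeight F E c N (rightShift F E c N y z) := fun z y hy =>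
    (borelQuotHeight_le_mul_rightShift_of_forall (fun x y hy => (hcmp x y hy).2) z hy).trans (mul_le_mul_of_nonneg_right (le_max_right κ₂ κ₃) zero_le)
  refine ⟨max κ₂ κ₃, hκ₂.trans (le_max_left _ _), hcmp', T, hTf, fun c₁ c₀ h01 hc => ?_⟩
  have hs : ShiftBound F E c N k c₁ c₀ νG μZ h := hsB k c₁ c₀ ((mul_le_mul_of_nonneg_right (le_max_left κ₂ κ₃) zero_le).trans hc) h hhc.measurable hhi hsupp
  refine ⟨hs, fun hb => ?_⟩
  exact deltaShift_comp_iota νG μ μZ hs hb h01 hright hΩm (lt_of_lt_of_le zero_lt_one (hκ₃.trans (le_max_right _ _))) hc hcmp' hsupp T hTf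

end Hecke

/-! ## §2a Finiteness and non-vanishing of `μZ(Z_c)` — generic reductions -/

section Generic

variable {F E : Type} [Field F] [NumberField F] [Field E] [NumberField E] [Algebra F E] {c : E ≃ₐ[F] E} {N : ℕ} [NeZero N]

/-- `μZ(Z_c) < ∞` from the finiteness of the weight-`0` truncated measure (`wtm 0 c μZ = μZ|_{Z_c}`). [cite: BernsteinLapid2019, §4 p. 10] -/
theorem measure_setOf_lt_ne_top_of_isFiniteMeasure {c₁ : ℝ≥0} {μZ : Measure (borelQuotient F E c N)} [IsFiniteMeasure (weightedTruncMeasure F E c N 0 c₁ μZ)] :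
    μZ {z | c₁ < borelQuotHeight F E c N z} ≠ ∞ := by
  have h1 : weightedTruncMeasure F E c N 0 c₁ μZ = μZ.restrict {z | c₁ < borelQuotHeight F E c N z} := by
    rw [weightedTruncMeasure]
    simp only [mul_zero, pow_zero, ENNReal.coe_one]
    exact withDensity_one
  have h2 := measure_lt_top (weightedTruncMeasure F E c N 0 c₁ μZ) univ
  rw [h1, Measure.restrict_apply_univ] at h2
  exact h2.ne

/-- `μZ(Z_c) ≠ 0` as soon as the weighted truncated measure of `univ` is non-zero. [cite: BernsteinLapid2019, §4 p. 10] -/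
theorem measure_setOf_lt_ne_zero_of_weightedTruncMeasure_ne_zero {k : ℕ} {c₁ : ℝ≥0} {μZ : Measure (borelQuotient F E c N)} (h : weightedTruncMeasure F E c N k c₁ μZ univ ≠ 0) :
    μZ {z | c₁ < borelQuotHeight F E c N z} ≠ 0 := by
  intro h0
  apply h
  have h1 : μZ.restrict {z | c₁ < borelQuotHeight F E c N z} = 0 := Measure.restrict_eq_zero.2 h0
  rw [weightedTruncMeasure, h1, withDensity_zero_left]
  rfl

end Generic

/-! ## §2b The CM `N = 2` discharge of `hfin`, `hne` -/

section CM

variable (L : Type) [Field L] [NumberField L] [IsCMField L]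
  [MeasurableSpace (quasiSplit (↥(maximalRealSubfield L)) L (IsCMField.complexConj L) 2).Adelic] [BorelSpace (quasiSplit (↥(maximalRealSubfield L)) L (IsCMField.complexConj L) 2).Adelic]

/-- **`μZ(Z_c) < ∞` for the CM datum** (every `c > 0`; ★ `isFiniteMeasure_weightedTruncMeasure_cm` at weight `0`) — the letter `hfin`. [cite: BernsteinLapid2019, §4 p. 10] -/
theorem measure_setOf_lt_ne_top_cm
    (μ : Measure (quasiSplit (↥(maximalRealSubfield L)) L (IsCMField.complexConj L) 2).automorphicQuotient)
    [(quasiSplit (↥(maximalRealSubfield L)) L (IsCMField.complexConj L) 2).IsAutomorphicMeasure μ]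
    (νG : Measure (quasiSplit (↥(maximalRealSubfield L)) L (IsCMField.complexConj L) 2).Adelic) [νG.IsHaarMeasure] [νG.IsInvInvariant]
    {β : (quasiSplit (↥(maximalRealSubfield L)) L (IsCMField.complexConj L) 2).Adelic → ℝ≥0∞}
    (hβ : IsCoveringWeight ↥((arithmeticBorel (↥(maximalRealSubfield L)) L (IsCMField.complexConj L) 2).map
      (quasiSplit (↥(maximalRealSubfield L)) L (IsCMField.complexConj L) 2).arithmeticSubgroup.subtype) β)
    {μZ : Measure (borelQuotient (↥(maximalRealSubfield L)) L (IsCMField.complexConj L) 2)}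
    (hμZ : ∀ f : borelQuotient (↥(maximalRealSubfield L)) L (IsCMField.complexConj L) 2 → ℝ≥0∞, Measurable f →
      ∫⁻ z, f z ∂μZ = ∫⁻ g, β g * f (toBorelQuotient (↥(maximalRealSubfield L)) L (IsCMField.complexConj L) 2 g) ∂νG) {c₀ : ℝ≥0} (hc : 0 < c₀) :
    μZ {z | c₀ < borelQuotHeight (↥(maximalRealSubfield L)) L (IsCMField.complexConj L) 2 z} ≠ ∞ := by
  haveI := isFiniteMeasure_weightedTruncMeasure_cm L μ νG hβ hμZ hc 0
  exact measure_setOf_lt_ne_top_of_isFiniteMeasure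

/-- **`μZ(Z_c) ≠ 0` for the CM datum below the closed-embedding threshold** (★ unfolding lower bound `A·∫⁻ Φ·w₁^{−2k} dμ ≤ ∫⁻ Φ∘p d(wtm)` at `Φ ≡ 1`; `w₁^{−2k} > 0`, `μ` positive on
the non-empty open `univ`) — the letter `hne`. [cite: BernsteinLapid2019, §4 p. 10] -/
theorem exists_pos_forall_measure_setOf_lt_ne_zero_cm
    (μ : Measure (quasiSplit (↥(maximalRealSubfield L)) L (IsCMField.complexConj L) 2).automorphicQuotient)
    [(quasiSplit (↥(maximalRealSubfield L)) L (IsCMField.complexConj L) 2).IsAutomorphicMeasure μ]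
    (νG : Measure (quasiSplit (↥(maximalRealSubfield L)) L (IsCMField.complexConj L) 2).Adelic) [νG.IsHaarMeasure] [νG.IsInvInvariant]
    {β : (quasiSplit (↥(maximalRealSubfield L)) L (IsCMField.complexConj L) 2).Adelic → ℝ≥0∞}
    (hβ : IsCoveringWeight ↥((arithmeticBorel (↥(maximalRealSubfield L)) L (IsCMField.complexConj L) 2).map
      (quasiSplit (↥(maximalRealSubfield L)) L (IsCMField.complexConj L) 2).arithmeticSubgroup.subtype) β)
    {μZ : Measure (borelQuotient (↥(maximalRealSubfield L)) L (IsCMField.complexConj L) 2)}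
    (hμZ : ∀ f : borelQuotient (↥(maximalRealSubfield L)) L (IsCMField.complexConj L) 2 → ℝ≥0∞, Measurable f →
      ∫⁻ z, f z ∂μZ = ∫⁻ g, β g * f (toBorelQuotient (↥(maximalRealSubfield L)) L (IsCMField.complexConj L) 2 g) ∂νG) (k : ℕ) :
    ∃ c₁ : ℝ≥0, 0 < c₁ ∧ ∀ c₀ : ℝ≥0, 0 < c₀ → c₀ < c₁ →
      μZ {z | c₀ < borelQuotHeight (↥(maximalRealSubfield L)) L (IsCMField.complexConj L) 2 z} ≠ 0 := by
  obtain ⟨c₁, hc₁, hlow⟩ := exists_pos_forall_mul_lintegral_le_lintegral_comp_pZX_cm L μ νG hβ hμZ k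
  refine ⟨c₁, hc₁, fun c₀ hc₀ hc₀₁ => ?_⟩
  obtain ⟨A, hA0, -, hAle⟩ := hlow c₀ hc₀ hc₀₁
  refine measure_setOf_lt_ne_zero_of_weightedTruncMeasure_ne_zero (k := k) ?_
  have hΦ := hAle (fun _ => 1) measurable_const
  simp only [one_mul] at hΦ
  rw [lintegral_const, one_mul] at hΦ
  intro h0
  rw [h0, nonpos_iff_eq_zero, mul_eq_zero] at hΦ
  rcases hΦ with h | h
  · exact hA0 h
  · have hwm : Measurable fun x : (quasiSplit (↥(maximalRealSubfield L)) L (IsCMField.complexConj L) 2).automorphicQuotient =>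
        ((supHeight (↥(maximalRealSubfield L)) L (IsCMField.complexConj L) 2 x)⁻¹ ^ (2 * k) : ℝ≥0) := measurable_supHeight.inv.pow_const _
    rw [lintegral_eq_zero_iff hwm.coe_nnreal_ennreal] at h
    have hfalse : ∀ᵐ x ∂μ, False := by
      filter_upwards [h] with x hx
      rw [Pi.zero_apply, ENNReal.coe_eq_zero] at hx
      exact absurd hx (pow_pos (inv_pos.2 (supHeight_pos x)) _).ne'
    rw [eventually_false_iff_eq_bot, ae_eq_bot] at hfalse
    have hne : (univ : Set (quasiSplit (↥(maximalRealSubfield L)) L (IsCMField.complexConj L) 2).automorphicQuotient).Nonempty :=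
      ⟨(quasiSplit (↥(maximalRealSubfield L)) L (IsCMField.complexConj L) 2).toAutomorphicQuotient 1, mem_univ _⟩
    have hpos := isOpen_univ.measure_ne_zero μ hne
    rw [hfalse] at hpos
    exact hpos rfl

end CM

end Summit.HodgeConjecture.HodgeConjecture.Cruxes.H413.K2E1SphericalEisensteinMeromorphicSuppliersU2

end
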